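import Summits.AtomisticToContinuum.HydrodynamicLimit.Theses.RelayRaceLocality
import Literature.Analysis.FunctionSpaces.TorusSpaceTime
import Literature.MathematicalPhysics.KineticTheory.HardSphereEulerProofs
import HarnessLib

/-!
# Crux `RestartPrinciple` (stmt-AtomisticToContinuum-12503), line `Sketch` — stub `stub_restartGlue`

Support file for the crux `Summit.AtomisticToContinuum.HydrodynamicLimit.Theses.RelayRaceLocality.RestartPrinciple`
(route `RelayRaceLocality`), line `Sketch` (idea `glauber-laundering-restart`): the PROVABLE glue of the
registered skeleton `Cruxes/RestartPrinciple/Lines/Sketch.lean` (v3).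

`stub_restartGlue : RestartableS → LaunderedRestart → SolutionShift → ProbTransfer → RestartableHL`:
the short-time hydrodynamic limit for FRESH local Gibbs gases (uniform prefix), plus laundering in law
at a restart time `s₀` (a fresh local Gibbs gas with profiles `(a, u s₀, θ s₀)` reproducing the LLN at
`s₀` and the forward bounded-Lipschitz statistics of the true law), plus the time shift of the classical
Euler solution and the transfer of convergence in probability along asymptotically equal statistics,
give the short-time limit in the RESTARTABLE currency along the TRUE law (restart from any `s₀ ∈ [0,T)`
given the LLN on `[0, s₀]`, window `τ₁ = min τ_R τ_L`, band `η₀ = min η_R η_L`,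
`σ₀ = min σ_R σ_L (1/2)`).

Proof: bookkeeping of the prefixes; the laundered gas is run for the window `w = t - s₀`; the true
law's LLN at `t = s₀ + w` is read off the fresh gas's LLN at `w` (from `RestartableS` applied to the
shifted solution) through `ProbTransfer`, component by component (density / momentum / energy), the
local Gibbs laws being probability measures for `σ ≤ 1/2` (`isProbabilityMeasure_localGibbsLaw`) and the
empirical fields measurable (finite averages of continuous functions of the configuration).
-/

noncomputable section

open Literature.MathematicalPhysics.KineticTheory Literature.Analysis.FluidPDE
open Literature.Analysis.FunctionSpaces MeasureTheory Filter Set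
open Summit.AtomisticToContinuum.HydrodynamicLimit.Theses.RelayRaceLocality

namespace Summit.AtomisticToContinuum.HydrodynamicLimit.Theorems.RestartPrinciple

/-! ## Measurability of the empirical fields -/

/-- The empirical density field tested against a continuous `χ` is a measurable function of the
configuration (a finite average of continuous functions). -/
theorem measurable_empiricalDensityField_of_continuous {N : ℕ} {χ : T3 → ℝ} (hχ : Continuous χ) :
    Measurable fun z : Config (N + 1) (Fin 3) T3 => empiricalDensityField z χ := by
  have h : (fun z : Config (N + 1) (Fin 3) T3 => empiricalDensityField z χ) =
      fun z => ((N + 1 : ℕ) : ℝ)⁻¹ * ∑ i, χ (z i).1 :=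
    funext fun z => empiricalDensityField_eq_sum z χ
  rw [h]
  exact measurable_const.mul
    (Finset.measurable_sum _ fun i _ => hχ.measurable.comp (measurable_pi_apply i).fst)

/-- The empirical momentum field tested against a continuous `χ` is measurable. -/
theorem measurable_empiricalMomentumField_of_continuous {N : ℕ} {χ : T3 → ℝ} (hχ : Continuous χ) :
    Measurable fun z : Config (N + 1) (Fin 3) T3 => empiricalMomentumField z χ := by
  have h : (fun z : Config (N + 1) (Fin 3) T3 => empiricalMomentumField z χ) =
      fun z => ((N + 1 : ℕ) : ℝ)⁻¹ • ∑ i, χ (z i).1 • (z i).2 :=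
    funext fun z => empiricalMomentumField_eq_sum z χ
  rw [h]
  have hsum : Measurable fun z : Config (N + 1) (Fin 3) T3 => ∑ i, χ (z i).1 • (z i).2 :=
    Finset.measurable_sum Finset.univ fun i _ =>
      (hχ.measurable.comp (measurable_pi_apply i).fst).smul (measurable_pi_apply i).snd
  exact hsum.const_smul (((N + 1 : ℕ) : ℝ)⁻¹)

/-- The empirical energy field tested against a continuous `χ` is measurable. -/
theorem measurable_empiricalEnergyField_of_continuous {N : ℕ} {χ : T3 → ℝ} (hχ : Continuous χ) :
    Measurable fun z : Config (N + 1) (Fin 3) T3 => empiricalEnergyField z χ := by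
  have h : (fun z : Config (N + 1) (Fin 3) T3 => empiricalEnergyField z χ) =
      fun z => ((N + 1 : ℕ) : ℝ)⁻¹ * ∑ i, χ (z i).1 * (‖(z i).2‖ ^ 2 / 2) :=
    funext fun z => empiricalEnergyField_eq_sum z χ
  rw [h]
  refine measurable_const.mul (Finset.measurable_sum _ fun i _ => ?_)
  have hx : Measurable fun z : Config (N + 1) (Fin 3) T3 => χ (z i).1 :=
    hχ.measurable.comp (measurable_pi_apply i).fst
  have hv : Measurable fun z : Config (N + 1) (Fin 3) T3 => ‖(z i).2‖ ^ 2 / 2 := by fun_prop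
  exact hx.mul hv

/-! ## The glue -/

/-- GLUE (registered stub `stub_restartGlue` of the line skeleton): fresh-gas short-time limit +
laundering in law + time shift + probabilistic transfer ⟹ the restartable short-time limit along the
true law. -/
theorem stub_restartGlue :
    (∃ η₀ : ℝ, 0 < η₀ ∧ ∃ σ₀ : ℝ, 0 < σ₀ ∧ ∀ σ : ℝ, 0 < σ → σ < σ₀ → ∀ M : ℝ, 0 < M →
      ∃ τ₁ : ℝ, 0 < τ₁ ∧ ∀ (a₀ θ₀ : T3 → ℝ) (u₀ : T3 → V3), Continuous a₀ → Continuous θ₀ →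
      Continuous u₀ → (∀ x, 0 < a₀ x) → (∀ x, 0 < θ₀ x) →
      ∀ (T : ℝ) (ρ θ : ℝ → T3 → ℝ) (u : ℝ → T3 → V3), IsHardSphereEulerSolution σ T ρ u θ →
      ∀ Φ : (N : ℕ) → HardSphereFlow (Torus.geometry (Fin 3)) (hsDiameter σ N) (N + 1),
      TendstoHydroFieldsAt (fun N => localGibbsLaw σ a₀ u₀ θ₀ N (Φ N)) Φ ρ u θ 0 →
      ∀ t ∈ Set.Ico 0 (min T τ₁),
      (∀ s ∈ Set.Icc 0 t, ∀ x, ρ s x * σ ^ 3 < η₀ ∧ ρ s x ≤ M ∧ θ s x ≤ M ∧ M⁻¹ ≤ θ s x ∧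
        ‖u s x‖ ≤ M ∧ ∀ i j k : Fin 3, |Torus.partialDeriv i (ρ s) x| ≤ M ∧
        ‖Torus.partialDeriv i (u s) x‖ ≤ M ∧ |Torus.partialDeriv i (θ s) x| ≤ M ∧
        |Torus.partialDeriv i (Torus.partialDeriv j (ρ s)) x| ≤ M ∧
        ‖Torus.partialDeriv i (Torus.partialDeriv j (u s)) x‖ ≤ M ∧
        |Torus.partialDeriv i (Torus.partialDeriv j (θ s)) x| ≤ M ∧
        |Torus.partialDeriv i (Torus.partialDeriv j (Torus.partialDeriv k (ρ s))) x| ≤ M ∧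
        ‖Torus.partialDeriv i (Torus.partialDeriv j (Torus.partialDeriv k (u s))) x‖ ≤ M ∧
        |Torus.partialDeriv i (Torus.partialDeriv j (Torus.partialDeriv k (θ s))) x| ≤ M) →
      TendstoHydroFieldsAt (fun N => localGibbsLaw σ a₀ u₀ θ₀ N (Φ N)) Φ ρ u θ t) →
    (∃ η₀ : ℝ, 0 < η₀ ∧ ∀ (a₀ θ₀ : T3 → ℝ) (u₀ : T3 → V3), Continuous a₀ → Continuous θ₀ →
      Continuous u₀ → (∀ x, 0 < a₀ x) → (∀ x, 0 < θ₀ x) → ∃ σ₀ : ℝ, 0 < σ₀ ∧ ∀ σ : ℝ, 0 < σ →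
      σ < σ₀ → ∀ M : ℝ, 0 < M → ∃ τ : ℝ, 0 < τ ∧ ∀ (T : ℝ) (ρ θ : ℝ → T3 → ℝ) (u : ℝ → T3 → V3),
      IsHardSphereEulerSolution σ T ρ u θ →
      ∀ Φ : (N : ℕ) → HardSphereFlow (Torus.geometry (Fin 3)) (hsDiameter σ N) (N + 1),
      ∀ s₀ ∈ Set.Ico 0 T,
      (∀ s ∈ Set.Icc 0 s₀,
        TendstoHydroFieldsAt (fun N => localGibbsLaw σ a₀ u₀ θ₀ N (Φ N)) Φ ρ u θ s) →
      (∀ s ∈ Set.Icc 0 s₀, ∀ x, ρ s x * σ ^ 3 < η₀ ∧ ρ s x ≤ M ∧ θ s x ≤ M ∧ M⁻¹ ≤ θ s x ∧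
        ‖u s x‖ ≤ M ∧ ∀ i j k : Fin 3, |Torus.partialDeriv i (ρ s) x| ≤ M ∧
        ‖Torus.partialDeriv i (u s) x‖ ≤ M ∧ |Torus.partialDeriv i (θ s) x| ≤ M ∧
        |Torus.partialDeriv i (Torus.partialDeriv j (ρ s)) x| ≤ M ∧
        ‖Torus.partialDeriv i (Torus.partialDeriv j (u s)) x‖ ≤ M ∧
        |Torus.partialDeriv i (Torus.partialDeriv j (θ s)) x| ≤ M ∧
        |Torus.partialDeriv i (Torus.partialDeriv j (Torus.partialDeriv k (ρ s))) x| ≤ M ∧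
        ‖Torus.partialDeriv i (Torus.partialDeriv j (Torus.partialDeriv k (u s))) x‖ ≤ M ∧
        |Torus.partialDeriv i (Torus.partialDeriv j (Torus.partialDeriv k (θ s))) x| ≤ M) →
      ∃ a : T3 → ℝ, Continuous a ∧ (∀ x, 0 < a x) ∧
        TendstoHydroFieldsAt (fun N => localGibbsLaw σ a (u s₀) (θ s₀) N (Φ N)) Φ
          (fun t => ρ (s₀ + t)) (fun t => u (s₀ + t)) (fun t => θ (s₀ + t)) 0 ∧
        ∀ w : ℝ, 0 ≤ w → w ≤ τ → s₀ + w < T →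
        (∀ s ∈ Set.Icc 0 (s₀ + w), ∀ x, ρ s x * σ ^ 3 < η₀ ∧ ρ s x ≤ M ∧ θ s x ≤ M ∧ M⁻¹ ≤ θ s x ∧
        ‖u s x‖ ≤ M ∧ ∀ i j k : Fin 3, |Torus.partialDeriv i (ρ s) x| ≤ M ∧
        ‖Torus.partialDeriv i (u s) x‖ ≤ M ∧ |Torus.partialDeriv i (θ s) x| ≤ M ∧
        |Torus.partialDeriv i (Torus.partialDeriv j (ρ s)) x| ≤ M ∧
        ‖Torus.partialDeriv i (Torus.partialDeriv j (u s)) x‖ ≤ M ∧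
        |Torus.partialDeriv i (Torus.partialDeriv j (θ s)) x| ≤ M ∧
        |Torus.partialDeriv i (Torus.partialDeriv j (Torus.partialDeriv k (ρ s))) x| ≤ M ∧
        ‖Torus.partialDeriv i (Torus.partialDeriv j (Torus.partialDeriv k (u s))) x‖ ≤ M ∧
        |Torus.partialDeriv i (Torus.partialDeriv j (Torus.partialDeriv k (θ s))) x| ≤ M) →
        ∀ χ : T3 → ℝ, Continuous χ →
          (∀ F : ℝ → ℝ, LipschitzWith 1 F → (∀ p, |F p| ≤ 1) →
            Tendsto (fun N => (∫ z, F (empiricalDensityField ((Φ N).flow (s₀ + w) z) χ)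
                ∂(localGibbsLaw σ a₀ u₀ θ₀ N (Φ N))) -
              ∫ z, F (empiricalDensityField ((Φ N).flow w z) χ)
                ∂(localGibbsLaw σ a (u s₀) (θ s₀) N (Φ N))) atTop (nhds 0)) ∧
          (∀ F : V3 → ℝ, LipschitzWith 1 F → (∀ p, |F p| ≤ 1) →
            Tendsto (fun N => (∫ z, F (empiricalMomentumField ((Φ N).flow (s₀ + w) z) χ)
                ∂(localGibbsLaw σ a₀ u₀ θ₀ N (Φ N))) -
              ∫ z, F (empiricalMomentumField ((Φ N).flow w z) χ)
                ∂(localGibbsLaw σ a (u s₀) (θ s₀) N (Φ N))) atTop (nhds 0)) ∧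
          (∀ F : ℝ → ℝ, LipschitzWith 1 F → (∀ p, |F p| ≤ 1) →
            Tendsto (fun N => (∫ z, F (empiricalEnergyField ((Φ N).flow (s₀ + w) z) χ)
                ∂(localGibbsLaw σ a₀ u₀ θ₀ N (Φ N))) -
              ∫ z, F (empiricalEnergyField ((Φ N).flow w z) χ)
                ∂(localGibbsLaw σ a (u s₀) (θ s₀) N (Φ N))) atTop (nhds 0))) →
    (∀ (σ T : ℝ) (ρ θ : ℝ → T3 → ℝ) (u : ℝ → T3 → V3), IsHardSphereEulerSolution σ T ρ u θ →
      ∀ s₀ : ℝ, 0 ≤ s₀ →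
        IsHardSphereEulerSolution σ (T - s₀) (fun t => ρ (s₀ + t)) (fun t => u (s₀ + t))
          (fun t => θ (s₀ + t))) →
    (∀ (E : Type) [NormedAddCommGroup E] [MeasurableSpace E] [BorelSpace E]
      (μ ν : (N : ℕ) → Measure (Config (N + 1) (Fin 3) T3))
      (A B : (N : ℕ) → Config (N + 1) (Fin 3) T3 → E) (c : E),
      (∀ N, IsProbabilityMeasure (μ N)) → (∀ N, IsProbabilityMeasure (ν N)) →
      (∀ N, Measurable (A N)) → (∀ N, Measurable (B N)) →
      (∀ F : E → ℝ, LipschitzWith 1 F → (∀ p, |F p| ≤ 1) →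
        Tendsto (fun N => (∫ z, F (A N z) ∂μ N) - ∫ z, F (B N z) ∂ν N) atTop (nhds 0)) →
      (∀ δ : ℝ, 0 < δ → Tendsto (fun N => ν N {z | δ < ‖B N z - c‖}) atTop (nhds 0)) →
      ∀ δ : ℝ, 0 < δ → Tendsto (fun N => μ N {z | δ < ‖A N z - c‖}) atTop (nhds 0)) →
    ∃ η₀ : ℝ, 0 < η₀ ∧ ∀ (a₀ θ₀ : T3 → ℝ) (u₀ : T3 → V3), Continuous a₀ → Continuous θ₀ →
      Continuous u₀ → (∀ x, 0 < a₀ x) → (∀ x, 0 < θ₀ x) → ∃ σ₀ : ℝ, 0 < σ₀ ∧ ∀ σ : ℝ, 0 < σ →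
      σ < σ₀ → ∀ M : ℝ, 0 < M → ∃ τ₁ : ℝ, 0 < τ₁ ∧ ∀ (T : ℝ) (ρ θ : ℝ → T3 → ℝ) (u : ℝ → T3 → V3),
      IsHardSphereEulerSolution σ T ρ u θ →
      ∀ Φ : (N : ℕ) → HardSphereFlow (Torus.geometry (Fin 3)) (hsDiameter σ N) (N + 1),
      ∀ s₀ ∈ Set.Ico 0 T,
      (∀ s ∈ Set.Icc 0 s₀,
        TendstoHydroFieldsAt (fun N => localGibbsLaw σ a₀ u₀ θ₀ N (Φ N)) Φ ρ u θ s) →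
      ∀ t ∈ Set.Ico s₀ (min T (s₀ + τ₁)),
      (∀ s ∈ Set.Icc 0 t, ∀ x, ρ s x * σ ^ 3 < η₀ ∧ ρ s x ≤ M ∧ θ s x ≤ M ∧ M⁻¹ ≤ θ s x ∧
        ‖u s x‖ ≤ M ∧ ∀ i j k : Fin 3, |Torus.partialDeriv i (ρ s) x| ≤ M ∧
        ‖Torus.partialDeriv i (u s) x‖ ≤ M ∧ |Torus.partialDeriv i (θ s) x| ≤ M ∧
        |Torus.partialDeriv i (Torus.partialDeriv j (ρ s)) x| ≤ M ∧
        ‖Torus.partialDeriv i (Torus.partialDeriv j (u s)) x‖ ≤ M ∧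
        |Torus.partialDeriv i (Torus.partialDeriv j (θ s)) x| ≤ M ∧
        |Torus.partialDeriv i (Torus.partialDeriv j (Torus.partialDeriv k (ρ s))) x| ≤ M ∧
        ‖Torus.partialDeriv i (Torus.partialDeriv j (Torus.partialDeriv k (u s))) x‖ ≤ M ∧
        |Torus.partialDeriv i (Torus.partialDeriv j (Torus.partialDeriv k (θ s))) x| ≤ M) →
      TendstoHydroFieldsAt (fun N => localGibbsLaw σ a₀ u₀ θ₀ N (Φ N)) Φ ρ u θ t := by
  intro hRS hLR hSS hPT
  obtain ⟨ηR, hηR, σR, hσR, hR⟩ := hRS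
  obtain ⟨ηL, hηL, hL⟩ := hLR
  refine ⟨min ηR ηL, lt_min hηR hηL, fun a₀ θ₀ u₀ ha hθ hu ha0 hθ0 => ?_⟩
  obtain ⟨σL, hσL, hL⟩ := hL a₀ θ₀ u₀ ha hθ hu ha0 hθ0
  refine ⟨min (min σR σL) (1 / 2), lt_min (lt_min hσR hσL) (by norm_num), fun σ hσ hσlt M hM => ?_⟩
  have hσR' : σ < σR := lt_of_lt_of_le hσlt ((min_le_left _ _).trans (min_le_left _ _))
  have hσL' : σ < σL := lt_of_lt_of_le hσlt ((min_le_left _ _).trans (min_le_right _ _))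
  have hσ2 : σ ≤ 1 / 2 := hσlt.le.trans (min_le_right _ _)
  obtain ⟨τR, hτR, hR⟩ := hR σ hσ hσR' M hM
  obtain ⟨τL, hτL, hL⟩ := hL σ hσ hσL' M hM
  refine ⟨min τR τL, lt_min hτR hτL, ?_⟩
  intro T ρ θ u hsol Φ s₀ hs₀ hLLN t ht hguards
  -- the window `w = t - s₀`
  set w : ℝ := t - s₀ with hw
  have hw0 : 0 ≤ w := sub_nonneg.2 ht.1
  have htT : t < T := lt_of_lt_of_le ht.2 (min_le_left _ _)
  have htτ : t < s₀ + min τR τL := lt_of_lt_of_le ht.2 (min_le_right _ _)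
  have hwτL : w ≤ τL := by have := min_le_right τR τL; rw [hw]; linarith
  have hwτR : w < τR := by have := min_le_left τR τL; rw [hw]; linarith
  have hs₀w : s₀ + w = t := by rw [hw]; ring
  -- guards in the laundering band `ηL` on `[0, s₀]` and on `[0, s₀ + w] = [0, t]`
  have hguardL : ∀ s ∈ Set.Icc 0 s₀, ∀ x, ρ s x * σ ^ 3 < ηL ∧ ρ s x ≤ M ∧ θ s x ≤ M ∧
      M⁻¹ ≤ θ s x ∧ ‖u s x‖ ≤ M ∧ ∀ i j k : Fin 3, |Torus.partialDeriv i (ρ s) x| ≤ M ∧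
      ‖Torus.partialDeriv i (u s) x‖ ≤ M ∧ |Torus.partialDeriv i (θ s) x| ≤ M ∧
      |Torus.partialDeriv i (Torus.partialDeriv j (ρ s)) x| ≤ M ∧
      ‖Torus.partialDeriv i (Torus.partialDeriv j (u s)) x‖ ≤ M ∧
      |Torus.partialDeriv i (Torus.partialDeriv j (θ s)) x| ≤ M ∧
      |Torus.partialDeriv i (Torus.partialDeriv j (Torus.partialDeriv k (ρ s))) x| ≤ M ∧
      ‖Torus.partialDeriv i (Torus.partialDeriv j (Torus.partialDeriv k (u s))) x‖ ≤ M ∧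
      |Torus.partialDeriv i (Torus.partialDeriv j (Torus.partialDeriv k (θ s))) x| ≤ M := by
    intro s hs x
    have hg := hguards s ⟨hs.1, hs.2.trans ht.1⟩ x
    exact ⟨lt_of_lt_of_le hg.1 (min_le_right _ _), hg.2⟩
  have hguardLt : ∀ s ∈ Set.Icc 0 (s₀ + w), ∀ x, ρ s x * σ ^ 3 < ηL ∧ ρ s x ≤ M ∧ θ s x ≤ M ∧
      M⁻¹ ≤ θ s x ∧ ‖u s x‖ ≤ M ∧ ∀ i j k : Fin 3, |Torus.partialDeriv i (ρ s) x| ≤ M ∧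
      ‖Torus.partialDeriv i (u s) x‖ ≤ M ∧ |Torus.partialDeriv i (θ s) x| ≤ M ∧
      |Torus.partialDeriv i (Torus.partialDeriv j (ρ s)) x| ≤ M ∧
      ‖Torus.partialDeriv i (Torus.partialDeriv j (u s)) x‖ ≤ M ∧
      |Torus.partialDeriv i (Torus.partialDeriv j (θ s)) x| ≤ M ∧
      |Torus.partialDeriv i (Torus.partialDeriv j (Torus.partialDeriv k (ρ s))) x| ≤ M ∧
      ‖Torus.partialDeriv i (Torus.partialDeriv j (Torus.partialDeriv k (u s))) x‖ ≤ M ∧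
      |Torus.partialDeriv i (Torus.partialDeriv j (Torus.partialDeriv k (θ s))) x| ≤ M := by
    intro s hs x
    rw [hs₀w] at hs
    have hg := hguards s hs x
    exact ⟨lt_of_lt_of_le hg.1 (min_le_right _ _), hg.2⟩
  -- laundering at `s₀`, read at the window `w`
  obtain ⟨a, ha_c, ha_p, hfresh0, hclose⟩ := hL T ρ θ u hsol Φ s₀ hs₀ hLLN hguardL
  have hcloseW := hclose w hw0 hwτL (by rw [hs₀w]; exact htT) hguardLt
  -- the fresh gas: shifted classical solution, its profiles, its guards, its LLN at `w`
  have hsol' := hSS σ T ρ θ u hsol s₀ hs₀.1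
  have hθc : Continuous (θ s₀) := (hsol.smooth_temperature.isSmooth_slice hs₀).continuous
  have huc : Continuous (u s₀) := (hsol.smooth_velocity.isSmooth_slice hs₀).continuous
  have hθp : ∀ x, 0 < θ s₀ x := hsol.temperature_pos s₀ hs₀
  have hwI : w ∈ Set.Ico 0 (min (T - s₀) τR) := ⟨hw0, lt_min (by rw [hw]; linarith) hwτR⟩
  have hguardR : ∀ s ∈ Set.Icc 0 w, ∀ x, (fun t => ρ (s₀ + t)) s x * σ ^ 3 < ηR ∧
      (fun t => ρ (s₀ + t)) s x ≤ M ∧ (fun t => θ (s₀ + t)) s x ≤ M ∧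
      M⁻¹ ≤ (fun t => θ (s₀ + t)) s x ∧ ‖(fun t => u (s₀ + t)) s x‖ ≤ M ∧ ∀ i j k : Fin 3,
      |Torus.partialDeriv i ((fun t => ρ (s₀ + t)) s) x| ≤ M ∧
      ‖Torus.partialDeriv i ((fun t => u (s₀ + t)) s) x‖ ≤ M ∧
      |Torus.partialDeriv i ((fun t => θ (s₀ + t)) s) x| ≤ M ∧
      |Torus.partialDeriv i (Torus.partialDeriv j ((fun t => ρ (s₀ + t)) s)) x| ≤ M ∧
      ‖Torus.partialDeriv i (Torus.partialDeriv j ((fun t => u (s₀ + t)) s)) x‖ ≤ M ∧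
      |Torus.partialDeriv i (Torus.partialDeriv j ((fun t => θ (s₀ + t)) s)) x| ≤ M ∧
      |Torus.partialDeriv i (Torus.partialDeriv j (Torus.partialDeriv k ((fun t => ρ (s₀ + t)) s))) x| ≤ M ∧
      ‖Torus.partialDeriv i (Torus.partialDeriv j (Torus.partialDeriv k ((fun t => u (s₀ + t)) s))) x‖ ≤ M ∧
      |Torus.partialDeriv i (Torus.partialDeriv j (Torus.partialDeriv k ((fun t => θ (s₀ + t)) s))) x| ≤ M := by
    intro s hs x
    have hs' : s₀ + s ∈ Set.Icc 0 t := ⟨by linarith [hs.1, hs₀.1], by rw [← hs₀w]; linarith [hs.2]⟩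
    have hg := hguards (s₀ + s) hs' x
    exact ⟨lt_of_lt_of_le hg.1 (min_le_left _ _), hg.2⟩
  have hfreshw := hR a (θ s₀) (u s₀) ha_c hθc huc ha_p hθp (T - s₀) (fun t => ρ (s₀ + t))
    (fun t => θ (s₀ + t)) (fun t => u (s₀ + t)) hsol' Φ hfresh0 w hwI hguardR
  -- probability measures and measurability
  have hPμ : ∀ N, IsProbabilityMeasure (localGibbsLaw σ a₀ u₀ θ₀ N (Φ N)) := fun N =>
    isProbabilityMeasure_localGibbsLaw ha hθ hu ha0 hθ0 hσ2 N (Φ N)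
  have hQν : ∀ N, IsProbabilityMeasure (localGibbsLaw σ a (u s₀) (θ s₀) N (Φ N)) := fun N =>
    isProbabilityMeasure_localGibbsLaw ha_c hθc huc ha_p hθp hσ2 N (Φ N)
  -- transfer, component by component
  intro χ hχ δ hδ
  obtain ⟨hcD, hcM, hcE⟩ := hcloseW χ hχ
  refine ⟨?_, ?_, ?_⟩
  · have h := hPT ℝ (fun N => localGibbsLaw σ a₀ u₀ θ₀ N (Φ N))
      (fun N => localGibbsLaw σ a (u s₀) (θ s₀) N (Φ N))
      (fun N z => empiricalDensityField ((Φ N).flow t z) χ)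
      (fun N z => empiricalDensityField ((Φ N).flow w z) χ) (∫ x, χ x * ρ t x) hPμ hQν
      (fun N => (measurable_empiricalDensityField_of_continuous hχ).comp ((Φ N).measurable_flow t))
      (fun N => (measurable_empiricalDensityField_of_continuous hχ).comp ((Φ N).measurable_flow w))
      (fun F hF hF1 => by have h1 := hcD F hF hF1; rwa [hs₀w] at h1)
      (fun δ' hδ' => by
        have h1 := (hfreshw χ hχ δ' hδ').1
        simp only [hs₀w] at h1
        simpa only [Real.norm_eq_abs] using h1)
      δ hδ
    simpa only [Real.norm_eq_abs] using h
  · exact hPT V3 (fun N => localGibbsLaw σ a₀ u₀ θ₀ N (Φ N))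
      (fun N => localGibbsLaw σ a (u s₀) (θ s₀) N (Φ N))
      (fun N z => empiricalMomentumField ((Φ N).flow t z) χ)
      (fun N z => empiricalMomentumField ((Φ N).flow w z) χ) (∫ x, (χ x * ρ t x) • u t x) hPμ hQν
      (fun N => (measurable_empiricalMomentumField_of_continuous hχ).comp ((Φ N).measurable_flow t))
      (fun N => (measurable_empiricalMomentumField_of_continuous hχ).comp ((Φ N).measurable_flow w))
      (fun F hF hF1 => by have h1 := hcM F hF hF1; rwa [hs₀w] at h1)
      (fun δ' hδ' => by
        have h1 := (hfreshw χ hχ δ' hδ').2.1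
        simp only [hs₀w] at h1
        exact h1)
      δ hδ
  · have h := hPT ℝ (fun N => localGibbsLaw σ a₀ u₀ θ₀ N (Φ N))
      (fun N => localGibbsLaw σ a (u s₀) (θ s₀) N (Φ N))
      (fun N z => empiricalEnergyField ((Φ N).flow t z) χ)
      (fun N z => empiricalEnergyField ((Φ N).flow w z) χ)
      (∫ x, χ x * totalEnergyDensity (ρ t x) (u t x) (θ t x)) hPμ hQν
      (fun N => (measurable_empiricalEnergyField_of_continuous hχ).comp ((Φ N).measurable_flow t))
      (fun N => (measurable_empiricalEnergyField_of_continuous hχ).comp ((Φ N).measurable_flow w))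
      (fun F hF hF1 => by have h1 := hcE F hF hF1; rwa [hs₀w] at h1)
      (fun δ' hδ' => by
        have h1 := (hfreshw χ hχ δ' hδ').2.2
        simp only [hs₀w] at h1
        simpa only [Real.norm_eq_abs] using h1)
      δ hδ
    simpa only [Real.norm_eq_abs] using h

end Summit.AtomisticToContinuum.HydrodynamicLimit.Theorems.RestartPrinciple

end
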